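import Summits.QuantumFields.BalabanUV.Beta.GAN24.WardResidualRotatedVertexMass
import Summits.QuantumFields.BalabanUV.Beta.GAN24.CoarseGaugeSourceResponse
import Summits.QuantumFields.BalabanUV.Beta.SecondOrderSplitDecay
import Summits.QuantumFields.BalabanUV.Beta.GAN24.WardResidualFieldTotals

/-!
# `BalabanUV.Beta.GAN24.ResponseColumnSlabFlux` — binder row G-an2-4 ∕ (CONV-C), the (S) row ∕ (W-γ) one level up: **THE SLAB FLUX OF A RESPONSE COLUMN** —
# a single-coordinate FIELD weight `f(u_μ)` against the `ℋ`-column of the coarse bond `(μ, y)` of `G_j = coDressKBmAt ρ Lc (KInvStep Lc j)` sees ONLY the exit slice of the block of `y`: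
# `Σ'_u f(u_μ)·colH G_j Lc μ y κ u = 𝟙[κ = μ]·(stepScale_j·Lc^{d+1})⁻¹·Lc^d·f(Lc·y_μ + Lc − 1)` (every `j`, in-block root, bounded `f`)
# (G-an2-4 CRUX TEAM (2), seat `b2b-balaban-gan24-formalise-leaf-06` = the (γ) hand, gen 48)

NOT IN PRINT; OUR BOOKKEEPING ([folklore] BY NAME: the block decomposition `BiStencilZeroMode.tsum_eq_sum_box_tsum`, road-P2 g38's block covariance of the comb column
`WardResidualRotatedVertexMass.colH_comb_block`, road-P2 g41's single-coordinate DATA-weight law `CoarseGaugeSourceResponse.tsum_coord_colH` ((I2) of the charge tower), an2's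
`SecondOrderSplitDecay.summable_colH_mul_bdd`; 0 `def`, 0 cited fact, 0 `def … : Prop`, 0 sorry).  HONEST FRAMING (cell contract, verbatim): «discharging `BetaPertH` makes
Bałaban's UV stability UNCONDITIONAL — a real constructive-QFT result; it is NOT the continuum limit and NOT the Clay problem.»  HONEST DEPENDENCY (verbatim): «continuum YM on T⁴ ⇐
BetaPertH ∧ nine spine estimates (0/9 proved); BetaPertH ⇐ (D1) ∧ (D4) ∧ CAP+tail; G-an2-4 gates asym, D1 and NE2/3/4.»

WHY.  road-P2's (I2) sums the column over the DATA of a coarse slab; this file sums ONE column over a slab of FIELD positions — the refinement, slice by slice, of road-P2 g39's column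
total `WardResidualFieldTotals.colTotal_eq` (`Σ'_u colH = 𝟙[κ = μ]·Lc^d·(stepScale_j·Lc^{d+1})⁻¹`): the flux of the response to a unit datum through the hyperplane `u_μ = s` is
`cH_j·Lc^d` on the EXIT slice of its own block and `0` on every other slice (`f = 𝟙_{s}`).  By block covariance the field-slab sum of one column is the data-slab sum of (I2) at
`Lc^d` field positions.  ENGINE E-leaf06-g48-1 (kit j175017, D = 2, Lc = 3, B ∈ {3,5}, jb = 1's lower level): the profile is `cH_0·Lc^d·δ_{s, exit}` to 1e-16, and the TRANSVERSE
flux (data direction ≠ μ) vanishes to 1e-16 for the centred root — that transverse statement is NOT typed here (its root-generic form is open).  This is the lemma behind the two-level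
identity (C2) of RESULT R-leaf06-g48-2 (the (γ) source pairing one level up): face sums of partial block-contour sums of a response to 1-block-periodic data are slab fluxes, and these
live on exit slices only.
* §1 **`tsum_coordWeight_mul_colH`** (the law), `tsum_slabInd_mul_colH` (the flux through one hyperplane).
Asserts NO value of Bałaban's tables; NOTHING of (W-γ) ∕ (INV) ∕ (S) discharged; NEVER «G-an2-4 closed» as (CONV-C); NOT D1, NOT `BetaPertH`, NOT continuum, NOT Clay.
2026-08-22; no existing file touched.
-/

noncomputable section

open Finset
open scoped BigOperators
open Literature.MathematicalPhysics.QuantumFieldTheory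
open Literature.MathematicalPhysics.QuantumFieldTheory.Balaban1983to89
open Literature.MathematicalPhysics.QuantumFieldTheory.Balaban1983to89.Beta
open ExpKernelCalculus (Site MKer Decays)
open AffineAveraging (box toSite)
open AveragingContours (blk)
open OneStepKernelFamily (KInvStep colH)
open Summit.QuantumFields.BalabanUV.Beta.AxialDressingRooted (coDressKBmAt decays_coDressKBmAt_KInvStep one_le_of_neZero)
open Summit.QuantumFields.BalabanUV.Beta.BorderedHessian (stepScale)
open Summit.QuantumFields.BalabanUV.Beta.SecondOrderSplitDecay (summable_colH_mul_bdd)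
open Summit.QuantumFields.BalabanUV.Beta.GAN24.BiStencilZeroMode (tsum_eq_sum_box_tsum)
open Summit.QuantumFields.BalabanUV.Beta.GAN24.WardResidualRotatedVertexMass (colH_comb_block)
open Summit.QuantumFields.BalabanUV.Beta.GAN24.CoarseGaugeSourceResponse (tsum_coord_colH)
open Summit.QuantumFields.BalabanUV.Beta.GAN24.WardResidualFieldTotals (sum_box_ite_exit_eq)

namespace Summit.QuantumFields.BalabanUV.Beta.GAN24.ResponseColumnSlabFlux

variable {d : ℕ} {Lc : ℕ} [NeZero Lc] {r : Fin (d + 1) → ℕ}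

/-! ## §1 A single-coordinate field weight against one response column -/

/-- NOT IN PRINT; OUR BOOKKEEPING.  **THE SLAB FLUX OF A RESPONSE COLUMN** (in-block root `ρ = toSite r`, `G_j = coDressKBmAt ρ Lc (KInvStep Lc j)`, every `j`, bounded `f : ℤ → ℝ`,
coarse bond `(μ, y)`, field direction `κ`): `Σ'_u f(u_μ)·colH G_j Lc μ y κ u = 𝟙[κ = μ]·(stepScale_j·Lc^{d+1})⁻¹·Lc^d·f(Lc·y_μ + Lc − 1)` — a field weight depending on the
coordinate `μ` only sees the column of a `μ`-datum through the EXIT `μ`-slice of the block of `y` (block decomposition ⨾ `colH_comb_block` ⨾ road-P2's `tsum_coord_colH` at the `Lc^d`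
exit positions of the box). -/
theorem tsum_coordWeight_mul_colH (hr : r ∈ box (d + 1) Lc) (j : ℕ) (μ : Fin (d + 1)) (f : ℤ → ℝ) {B : ℝ} (hf : ∀ s, |f s| ≤ B)
    (y : Site (d + 1)) (κ : Fin (d + 1)) :
    ∑' u : Site (d + 1), f (u μ) * colH (coDressKBmAt (toSite r) Lc (KInvStep (d := d) Lc j)) Lc μ y κ u
      = (if κ = μ then (stepScale d Lc j * (Lc : ℝ) ^ (d + 1))⁻¹ * (Lc : ℝ) ^ d * f ((Lc : ℤ) * y μ + (Lc : ℤ) - 1) else 0) := by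
  classical
  have hLc : 1 ≤ Lc := one_le_of_neZero Lc
  set G := coDressKBmAt (toSite r) Lc (KInvStep (d := d) Lc j) with hGdef
  obtain ⟨δG, CG, hδG, hCG, hG⟩ := decays_coDressKBmAt_KInvStep (d := d) hr j
  have hGK : ∃ δ C : ℝ, 0 < δ ∧ 0 ≤ C ∧ Decays G C δ := ⟨δG, CG, hδG, hCG, hG⟩
  -- summability of the weighted column
  have hs : Summable fun u : Site (d + 1) => f (u μ) * colH G Lc μ y κ u :=
    (summable_colH_mul_bdd (N := Lc) hGK (T := fun u => f (u μ)) (fun u => hf (u μ)) μ y κ).congr fun u => mul_comm _ _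
  -- block decomposition of the field position: `u = Lc•t + v`
  rw [tsum_eq_sum_box_tsum (N := Lc) hs]
  -- per box position `v`: block covariance turns the `t`-sum into a single-coordinate DATA sum, evaluated by road-P2's law
  have hv : ∀ v ∈ box (d + 1) Lc, ∑' t : Site (d + 1), f (((Lc : ℤ) • t + toSite v) μ) * colH G Lc μ y κ ((Lc : ℤ) • t + toSite v)
      = (stepScale d Lc j * (Lc : ℝ) ^ (d + 1))⁻¹ * (if κ = μ ∧ ((v μ : ℕ) : ℤ) = (Lc : ℤ) - 1 then f ((Lc : ℤ) * y μ + (Lc : ℤ) - 1) else 0) := by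
    intro v hvb
    have hv' : ∀ i, v i < Lc := by simpa [AffineAveraging.box, Fintype.mem_piFinset, Finset.mem_range] using hvb
    -- covariance: `colH(μ,y)(κ, Lc•t + v) = colH(μ, y + (y − t))(κ, Lc•y + v)`
    set F : Site (d + 1) → ℝ := fun y' => f ((Lc : ℤ) * (2 * y μ - y' μ) + (v μ : ℕ)) * colH G Lc μ y' κ ((Lc : ℤ) • y + toSite v) with hFdef
    have e1 : ∀ t : Site (d + 1), f (((Lc : ℤ) • t + toSite v) μ) * colH G Lc μ y κ ((Lc : ℤ) • t + toSite v) = F (Equiv.subLeft (y + y) t) := fun t => by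
      rw [Equiv.subLeft_apply, hFdef]
      simp only [hGdef, colH_comb_block (toSite r) j μ κ v y t, ← add_sub_assoc]
      congr 1
      simp only [Pi.add_apply, Pi.smul_apply, Pi.sub_apply, smul_eq_mul, AffineAveraging.toSite]
      ring_nf
    rw [tsum_congr e1, (Equiv.subLeft (y + y)).tsum_eq F]
    simp only [hFdef]
    -- road-P2's single-coordinate data law with the bounded weight `F(c) := f(Lc(2y_μ − c) + v_μ)`
    have hF : ∀ c : ℤ, |f ((Lc : ℤ) * (2 * y μ - c) + (v μ : ℕ))| ≤ B := fun c => hf _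
    rw [hGdef, tsum_coord_colH hr j μ (fun c => f ((Lc : ℤ) * (2 * y μ - c) + (v μ : ℕ))) hF κ ((Lc : ℤ) • y + toSite v)]
    -- the field position `Lc•y + v`: exit iff `v_μ = Lc − 1`, block `y`
    have eblk : blk Lc ((Lc : ℤ) • y + toSite v) μ = y μ := by
      rw [AveragingContours.blk_block y hvb]
    have emod : ((Lc : ℤ) • y + toSite v) μ % (Lc : ℤ) = ((v μ : ℕ) : ℤ) := by
      simp only [Pi.add_apply, Pi.smul_apply, AffineAveraging.toSite, smul_eq_mul]
      rw [add_comm, Int.add_mul_emod_self_left]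
      exact Int.emod_eq_of_lt (by positivity) (by exact_mod_cast hv' μ)
    rw [emod, eblk]
    by_cases hκ : κ = μ ∧ ((v μ : ℕ) : ℤ) = (Lc : ℤ) - 1
    · rw [if_pos hκ, if_pos hκ]
      congr 2
      have : ((v μ : ℕ) : ℤ) = (Lc : ℤ) - 1 := hκ.2
      rw [this]; ring
    · rw [if_neg hκ, if_neg hκ]
  rw [Finset.sum_congr rfl hv, ← Finset.mul_sum]
  -- count the exit positions of the box: `Lc^d`
  by_cases hκ : κ = μ
  · subst hκ
    rw [if_pos rfl]
    have hcount : (∑ v ∈ box (d + 1) Lc, (if κ = κ ∧ ((v κ : ℕ) : ℤ) = (Lc : ℤ) - 1 then f ((Lc : ℤ) * y κ + (Lc : ℤ) - 1) else 0))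
        = (Lc : ℝ) ^ d * f ((Lc : ℤ) * y κ + (Lc : ℤ) - 1) := by
      have e : ∀ v ∈ box (d + 1) Lc, (if κ = κ ∧ ((v κ : ℕ) : ℤ) = (Lc : ℤ) - 1 then f ((Lc : ℤ) * y κ + (Lc : ℤ) - 1) else 0)
          = (if ((v κ : ℕ) : ℤ) = (Lc : ℤ) - 1 then (1 : ℝ) else 0) * f ((Lc : ℤ) * y κ + (Lc : ℤ) - 1) := fun v _ => by
        by_cases h : ((v κ : ℕ) : ℤ) = (Lc : ℤ) - 1
        · rw [if_pos ⟨rfl, h⟩, if_pos h, one_mul]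
        · rw [if_neg (fun hh => h hh.2), if_neg h, zero_mul]
      rw [Finset.sum_congr rfl e, ← Finset.sum_mul, sum_box_ite_exit_eq hLc κ 1, mul_one]
    rw [hcount]
    ring
  · rw [if_neg hκ]
    have e : ∀ v ∈ box (d + 1) Lc, (if κ = μ ∧ ((v μ : ℕ) : ℤ) = (Lc : ℤ) - 1 then f ((Lc : ℤ) * y μ + (Lc : ℤ) - 1) else 0) = 0 :=
      fun v _ => if_neg (fun hh => hκ hh.1)
    rw [Finset.sum_congr rfl e, Finset.sum_const_zero, mul_zero]

/-- NOT IN PRINT; OUR BOOKKEEPING.  **THE FLUX OF A RESPONSE COLUMN THROUGH ONE LATTICE HYPERPLANE**: `Σ'_u 𝟙[u_μ = s]·colH G_j Lc μ y κ u = 𝟙[κ = μ]·𝟙[s = Lc·y_μ + Lc − 1]·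
(stepScale_j·Lc^{d+1})⁻¹·Lc^d` — the column of a `μ`-datum carries field flux through the hyperplane `u_μ = s` only in its own direction and only through the EXIT slice of its own
block (ENGINE E-leaf06-g48-1, kit j175017: exact to 1e-16 at D = 2, Lc = 3; the slice-by-slice refinement of road-P2 g39's `WardResidualFieldTotals.colTotal_eq`). -/
theorem tsum_slabInd_mul_colH (hr : r ∈ box (d + 1) Lc) (j : ℕ) (μ : Fin (d + 1)) (s : ℤ) (y : Site (d + 1)) (κ : Fin (d + 1)) :
    ∑' u : Site (d + 1), (if u μ = s then (1 : ℝ) else 0) * colH (coDressKBmAt (toSite r) Lc (KInvStep (d := d) Lc j)) Lc μ y κ u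
      = (if κ = μ then (stepScale d Lc j * (Lc : ℝ) ^ (d + 1))⁻¹ * (Lc : ℝ) ^ d * (if (Lc : ℤ) * y μ + (Lc : ℤ) - 1 = s then (1 : ℝ) else 0) else 0) := by
  classical
  have h := tsum_coordWeight_mul_colH hr j μ (fun c : ℤ => if c = s then (1 : ℝ) else 0) (B := 1) (fun c => by split_ifs <;> simp) y κ
  simpa using h

end Summit.QuantumFields.BalabanUV.Beta.GAN24.ResponseColumnSlabFlux

end
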